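import Mathlib
import Literature.Analysis.Complex.VitaliConvergence
import Summits.Parity.BatemanHorn.Theses.SelbergDelangeRigidity
import HarnessLib

/-!
# `VitaliExtraction` (item stmt-Parity-9771, route `SelbergDelangeRigidity`, Parity/BatemanHorn)

Pure complex analysis behind the Selberg–Delange rigidity route: convergence of a locally bounded
family of entire functions on a REAL segment propagates, by Vitali–Porter, to locally uniform
convergence on a thin complex neighbourhood `V_η = {−η < Re z < 7/4, |Im z| < η}` of `[0, 7/4)`,
hence to convergence of all `z`-derivatives at `0`.

* `VitaliExtraction.tendsto_iteratedDeriv` — the abstract statement: `F n` entire, locally bounded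
  on a connected open `U`, `F n z → Ψ z` frequently near a point of `U` with `Ψ` holomorphic on
  `U`; then `iteratedDeriv m (F n) w → iteratedDeriv m Ψ w` for every `w ∈ U` and every `m`
  (Vitali: `Literature.Analysis.Complex.exists_tendstoLocallyUniformlyOn_of_frequently_tendsto`;
  identification of the limit by the identity theorem; Weierstrass' theorem on derivatives
  `TendstoLocallyUniformlyOn.deriv`, iterated).
* `vitaliExtraction_proof` — the route decl: `U = V_η` (open, convex, inside `|z| < 2` for
  `η ≤ 1/4`), `F x = H_x`, `Ψ z = Λ z · e^{(z−1) log D} · (Γ z)⁻¹^k` (holomorphic on `V_η` by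
  `Complex.differentiable_one_div_Gamma`), accumulation point `3/2` of the real segment
  `(5/4, 7/4)`, evaluation at `w = 0`, `m = k`.

Sources: Titchmarsh, *Theory of Functions* §5.21; Conway, *Functions of One Complex Variable* VII §2;
Tenenbaum, *Introduction to analytic and probabilistic number theory* II.5 (the Selberg–Delange
set-up). No definitions, nothing conditional.
-/

noncomputable section

open Filter Set Metric Topology

namespace Summit.Parity.BatemanHorn.Theorems

/-- **Vitali extraction of derivatives.** Let `F n : ℂ → ℂ` be entire functions, locally bounded
on a connected open set `U`, and suppose `F n z → Ψ z` for `z` frequently near some `z₀ ∈ U`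
(e.g. on a segment accumulating at `z₀`), where `Ψ` is holomorphic on `U`. Then for every `m` and
every `w ∈ U`, `iteratedDeriv m (F n) w → iteratedDeriv m Ψ w`. (Vitali–Porter gives a locally
uniform holomorphic limit `g` on `U`; `g = Ψ` on `U` by the identity theorem; derivatives converge
locally uniformly by Weierstrass' theorem.) [folklore] -/
theorem VitaliExtraction.tendsto_iteratedDeriv {U : Set ℂ} (hUo : IsOpen U)
    (hUc : IsPreconnected U) {F : ℕ → ℂ → ℂ} {Ψ : ℂ → ℂ} (hF : ∀ n, Differentiable ℂ (F n))
    (hΨ : DifferentiableOn ℂ Ψ U)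
    (hb : ∀ a ∈ U, ∃ M : ℝ, ∃ r > 0, ∀ n, ∀ z ∈ ball a r ∩ U, ‖F n z‖ ≤ M)
    {z₀ : ℂ} (hz₀ : z₀ ∈ U)
    (hconv : ∃ᶠ z in 𝓝[≠] z₀, Tendsto (fun n => F n z) atTop (𝓝 (Ψ z)))
    (m : ℕ) {w : ℂ} (hw : w ∈ U) :
    Tendsto (fun n => iteratedDeriv m (F n) w) atTop (𝓝 (iteratedDeriv m Ψ w)) := by
  -- Vitali–Porter
  have hS : ∃ᶠ z in 𝓝[≠] z₀, ∃ c : ℂ, Tendsto (fun n => F n z) atTop (𝓝 c) :=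
    hconv.mono fun z hz => ⟨_, hz⟩
  obtain ⟨g, hgd, hlim⟩ :=
    Literature.Analysis.Complex.exists_tendstoLocallyUniformlyOn_of_frequently_tendsto hUo hUc
      (fun n => (hF n).differentiableOn) hb hz₀ hS
  -- identification of the limit
  have heq : EqOn g Ψ U := by
    have hfreq : ∃ᶠ z in 𝓝[≠] z₀, g z = Ψ z := by
      have hev : ∀ᶠ z in 𝓝[≠] z₀, z ∈ U := mem_nhdsWithin_of_mem_nhds (hUo.mem_nhds hz₀)
      refine (hconv.and_eventually hev).mono fun z hz => ?_
      exact tendsto_nhds_unique (hlim.tendsto_at hz.2) hz.1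
    exact (hgd.analyticOnNhd hUo).eqOn_of_preconnected_of_frequently_eq (hΨ.analyticOnNhd hUo)
      hUc hz₀ hfreq
  -- all derivatives of the entire functions `F n` are entire
  have hFd : ∀ j n, Differentiable ℂ (iteratedDeriv j (F n)) := by
    intro j n
    induction j with
    | zero => simpa only [iteratedDeriv_zero] using hF n
    | succ j ih => simpa only [iteratedDeriv_succ] using ih.deriv
  -- Weierstrass: derivatives converge locally uniformly
  have hder : ∀ j, TendstoLocallyUniformlyOn (fun n => iteratedDeriv j (F n)) (iteratedDeriv j g)
      atTop U := by
    intro j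
    induction j with
    | zero => simpa only [iteratedDeriv_zero] using hlim
    | succ j ih =>
      have h := ih.deriv (Eventually.of_forall fun n => (hFd j n).differentiableOn) hUo
      simpa only [iteratedDeriv_succ, Function.comp_def] using h
  have h1 : Tendsto (fun n => iteratedDeriv m (F n) w) atTop (𝓝 (iteratedDeriv m g w)) :=
    (hder m).tendsto_at hw
  rwa [heq.iteratedDeriv_of_isOpen hUo m hw] at h1

/-- **`VitaliExtraction`** (item stmt-Parity-9771 of route `SelbergDelangeRigidity`): if `Λ` is
holomorphic on `|z| < 2`, `0 < η ≤ 1/4`, the family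
`H_x(z) = x⁻¹ · exp(k(1−z) log log x) · Σ_{n ≤ x} z^{Ω_f(n)}` is locally bounded on
`V_η = {−η < Re z < 7/4, |Im z| < η}` and `H_x(y) → Ψ(y) = Λ(y) e^{(y−1) log D} (Γ(y)⁻¹)^k` for real
`y ∈ (5/4, 7/4)`, then `iteratedDeriv k H_x 0 → iteratedDeriv k Ψ 0`. Each `H_x` is entire, `V_η`
is open and convex, contained in `|z| < 2` (since `(7/4)² + (1/4)² < 4`) and contains `0` and the
accumulation point `3/2` of the segment; apply `VitaliExtraction.tendsto_iteratedDeriv`.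
[folklore] -/
theorem vitaliExtraction_proof :
    Summit.Parity.BatemanHorn.Theses.SelbergDelangeRigidity.VitaliExtraction := by
  unfold Summit.Parity.BatemanHorn.Theses.SelbergDelangeRigidity.VitaliExtraction
  intro k f Λ η hη hη4 hΛ hb hU
  -- the rectangle `V_η`
  have hUo : IsOpen {z : ℂ | -η < z.re ∧ z.re < 7 / 4 ∧ |z.im| < η} :=
    (isOpen_lt continuous_const Complex.continuous_re).and
      ((isOpen_lt Complex.continuous_re continuous_const).and
        (isOpen_lt (continuous_abs.comp Complex.continuous_im) continuous_const))
  have hUc : IsPreconnected {z : ℂ | -η < z.re ∧ z.re < 7 / 4 ∧ |z.im| < η} := by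
    refine Convex.isPreconnected ?_
    have hUeq : {z : ℂ | -η < z.re ∧ z.re < 7 / 4 ∧ |z.im| < η} =
        {z : ℂ | -η < z.re} ∩ ({z : ℂ | z.re < 7 / 4} ∩ ({z : ℂ | -η < z.im} ∩ {z : ℂ | z.im < η})) := by
      ext z
      simp only [Set.mem_setOf_eq, Set.mem_inter_iff, abs_lt]
    rw [hUeq]
    exact (convex_halfSpace_re_gt _).inter ((convex_halfSpace_re_lt _).inter
      ((convex_halfSpace_im_gt _).inter (convex_halfSpace_im_lt _)))
  have hUsub : {z : ℂ | -η < z.re ∧ z.re < 7 / 4 ∧ |z.im| < η} ⊆ Metric.ball 0 2 := by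
    rintro z ⟨h1, h2, h3⟩
    rw [Metric.mem_ball, dist_zero_right]
    have hre : z.re ^ 2 < (7 / 4) ^ 2 := sq_lt_sq' (by linarith) h2
    have him : z.im ^ 2 < (1 / 4) ^ 2 := by
      obtain ⟨h4, h5⟩ := abs_lt.1 h3
      exact sq_lt_sq' (by linarith) (by linarith)
    have hns : ‖z‖ ^ 2 < 2 ^ 2 := by
      rw [Complex.sq_norm, Complex.normSq_apply]
      nlinarith
    exact lt_of_pow_lt_pow_left₀ 2 (by norm_num) hns
  have hz₀ : ((3 / 2 : ℝ) : ℂ) ∈ {z : ℂ | -η < z.re ∧ z.re < 7 / 4 ∧ |z.im| < η} := by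
    simp only [Set.mem_setOf_eq, Complex.ofReal_re, Complex.ofReal_im, abs_zero]
    exact ⟨by linarith, by norm_num, hη⟩
  have hw : (0 : ℂ) ∈ {z : ℂ | -η < z.re ∧ z.re < 7 / 4 ∧ |z.im| < η} := by
    simp only [Set.mem_setOf_eq, Complex.zero_re, Complex.zero_im, abs_zero]
    exact ⟨by linarith, by norm_num, hη⟩
  refine VitaliExtraction.tendsto_iteratedDeriv hUo hUc ?_ ?_ hb hz₀ ?_ k hw
  · -- each `H_x` is entire
    intro x
    fun_prop
  · -- `Ψ` is holomorphic on `V_η ⊆ ball 0 2`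
    have hG : Differentiable ℂ fun z : ℂ => (Complex.Gamma z)⁻¹ ^ k :=
      Complex.differentiable_one_div_Gamma.fun_pow k
    have hE : Differentiable ℂ fun z : ℂ =>
        Complex.exp ((z - 1) * (Real.log (∏ i, ((f i).natDegree : ℝ)) : ℂ)) := by
      fun_prop
    exact ((hΛ.mono hUsub).fun_mul hE.differentiableOn).fun_mul hG.differentiableOn
  · -- convergence on the real segment `(5/4, 7/4)`, which accumulates at `3/2`
    have htend : Tendsto (fun s : ℝ => (s : ℂ)) (𝓝[>] (3 / 2 : ℝ)) (𝓝[≠] ((3 / 2 : ℝ) : ℂ)) := by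
      have h1 : Tendsto (fun s : ℝ => (s : ℂ)) (𝓝[>] (3 / 2 : ℝ))
          (𝓝[{((3 / 2 : ℝ) : ℂ)}ᶜ] ((3 / 2 : ℝ) : ℂ)) :=
        Complex.continuous_ofReal.continuousWithinAt.tendsto_nhdsWithin fun s hs =>
          fun h => (ne_of_gt hs) (Complex.ofReal_injective h)
      simpa using h1
    have hev : ∀ᶠ s : ℝ in 𝓝[>] (3 / 2 : ℝ), s ∈ Set.Ioo (5 / 4 : ℝ) (7 / 4) :=
      mem_nhdsWithin_of_mem_nhds (isOpen_Ioo.mem_nhds ⟨by norm_num, by norm_num⟩)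
    exact htend.frequently (hev.mono fun s hs => hU s hs.1 hs.2).frequently

end Summit.Parity.BatemanHorn.Theorems

end
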